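import Literature.MathematicalPhysics.QuantumLattice.HubbardModelParticleHoleProofs
import Literature.MathematicalPhysics.QuantumLattice.FermionOperatorsProofs
import HarnessLib

/-!
# Charge of a ladder word and sector orthogonality

Family `hubbard` (trunk T-QLATTICE). A word `M = a₁ ⋯ aₖ` in creation / annihilation matrices
(`aⱼ ∈ {c†ᵢ, cᵢ}`) has CHARGE `q(M) = #creators − #annihilators ∈ ℤ` and maps the `N`-particle sector
into the `(N + q)`-particle sector — with the convention, forced by `ℤ`, that the image is the zero
vector when `N + q < 0` (`IsZParticle`, an integer-indexed variant of `IsNParticle` that is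
satisfied by `0` for every index). Consequently a word of NON-ZERO charge has vanishing expectation
in every vector of a fixed particle-number sector (`star_dotProduct_ladderWord_mulVec_eq_zero`).
This is the "charged moments vanish" rule of the number-conserving bootstrap (Han 2020 §2:
`⟨O⟩ = 0` unless `[N̂, O] = 0`) — the reason a rounded certificate may DROP the charged monomials of
its residual (bundle papers/HubbardSuperconductivity/manybody-bootstrap/, certificate format
`certsdp/1` §3, mode `sector`). Bratteli–Robinson II §5.2.2 for the sector action of `c†, c`.
Everything is PROVED; no named fact is introduced.

## References
* X. Han, *Quantum many-body bootstrap*, arXiv:2006.06002 (2020), §2. [cite: Han2020Bootstrap, §2]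
* O. Bratteli, D. W. Robinson, *Operator Algebras and Quantum Statistical Mechanics 2*, §5.2.2.
  [cite: BratteliRobinsonII1997, §5.2.2]
-/

noncomputable section

open Matrix Finset

namespace Literature.MathematicalPhysics.QuantumLattice

variable {ι : Type*} [Fintype ι] [LinearOrder ι]

/-- Integer-indexed sector predicate: `ψ` is supported on configurations of cardinality `K`
(vacuous for `K < 0`: only `ψ = 0`). [folklore] -/
def IsZParticle (K : ℤ) (ψ : Fock ι) : Prop := ∀ s : Finset ι, (s.card : ℤ) ≠ K → ψ s = 0

omit [Fintype ι] [LinearOrder ι] in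
/-- `IsNParticle N ψ ↔ IsZParticle N ψ`. [folklore] -/
theorem isZParticle_iff_isNParticle (N : ℕ) (ψ : Fock ι) :
    IsZParticle (N : ℤ) ψ ↔ IsNParticle N ψ := by
  constructor
  · intro h s hs; exact h s (by exact_mod_cast hs)
  · intro h s hs; exact h s (by exact_mod_cast hs)

/-- `c†ᵢ` raises the (integer) sector index by one. [cite: BratteliRobinsonII1997, §5.2.2] -/
theorem IsZParticle.creation_mulVec {K : ℤ} {ψ : Fock ι} (hψ : IsZParticle K ψ) (i : ι) :
    IsZParticle (K + 1) (creation i *ᵥ ψ) := by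
  intro s hs
  simp only [mulVec, dotProduct, creation, conjTranspose_apply, annihilation]
  refine sum_eq_zero fun t _ => ?_
  split_ifs with h
  · have ht : (t.card : ℤ) ≠ K := fun htK => hs (by rw [h.2, card_insert_of_notMem h.1]; push_cast; omega)
    rw [hψ t ht, mul_zero]
  · rw [star_zero, zero_mul]

/-- `cᵢ` lowers the (integer) sector index by one. [cite: BratteliRobinsonII1997, §5.2.2] -/
theorem IsZParticle.annihilation_mulVec {K : ℤ} {ψ : Fock ι} (hψ : IsZParticle K ψ) (i : ι) :
    IsZParticle (K - 1) (annihilation i *ᵥ ψ) := by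
  intro s hs
  rw [annihilation_mulVec_apply]
  by_cases hi : i ∈ s
  · rw [if_neg (not_not_intro hi)]
  · rw [if_pos hi, hψ _ (fun h => hs ?_), mul_zero]
    have hc : (insert i s).card = s.card + 1 := card_insert_of_notMem hi
    rw [hc] at h; push_cast at h; omega

/-- The ladder matrix of a letter `(i, dag)`. [folklore] -/
def ladderLetter (p : ι × Bool) : Matrix (Finset ι) (Finset ι) ℂ :=
  if p.2 then creation p.1 else annihilation p.1

/-- The ladder word `a₁ ⋯ aₖ` of a list of letters. [folklore] -/
def ladderWord (l : List (ι × Bool)) : Matrix (Finset ι) (Finset ι) ℂ := (l.map ladderLetter).prod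

/-- Charge of a word: `#creators − #annihilators`. [folklore] -/
def ladderCharge (l : List (ι × Bool)) : ℤ := (l.map fun p => if p.2 then (1 : ℤ) else -1).sum

/-- `ladderWord nil`. [folklore] -/
@[simp] theorem ladderWord_nil : ladderWord ([] : List (ι × Bool)) = 1 := by
  simp [ladderWord]

/-- `ladderWord cons`. [folklore] -/
@[simp] theorem ladderWord_cons (p : ι × Bool) (l : List (ι × Bool)) :
    ladderWord (p :: l) = ladderLetter p * ladderWord l := by
  simp [ladderWord]

omit [Fintype ι] [LinearOrder ι] in
/-- `ladderCharge nil`. [folklore] -/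
@[simp] theorem ladderCharge_nil : ladderCharge ([] : List (ι × Bool)) = 0 := by
  simp [ladderCharge]

omit [Fintype ι] [LinearOrder ι] in
/-- `ladderCharge cons`. [folklore] -/
@[simp] theorem ladderCharge_cons (p : ι × Bool) (l : List (ι × Bool)) :
    ladderCharge (p :: l) = (if p.2 then (1 : ℤ) else -1) + ladderCharge l := by
  simp [ladderCharge]

/-- `ladderWord l` agrees with the `List.prod` form used in
`Literature.MathematicalPhysics.QuantumLattice.isContraction_prod_ladder`. [folklore] -/
theorem ladderWord_eq_prod (l : List (ι × Bool)) :
    ladderWord l = (l.map fun p : ι × Bool => if p.2 then creation p.1 else annihilation p.1).prod :=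
  rfl

/-- **Sector action of a ladder word**: `IsZParticle K ψ → IsZParticle (K + q(l)) (ladderWord l ψ)`.
[cite: BratteliRobinsonII1997, §5.2.2] -/
theorem IsZParticle.ladderWord_mulVec {K : ℤ} {ψ : Fock ι} (hψ : IsZParticle K ψ)
    (l : List (ι × Bool)) : IsZParticle (K + ladderCharge l) (ladderWord l *ᵥ ψ) := by
  induction l generalizing K ψ with
  | nil => simpa using hψ
  | cons p l ih =>
    rw [ladderWord_cons, ← mulVec_mulVec, ladderCharge_cons]
    have h := ih hψ
    unfold ladderLetter
    obtain ⟨i, b⟩ := p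
    cases b
    · have := h.annihilation_mulVec i
      simp only [Bool.false_eq_true, if_false]
      rwa [show K + (-1 + ladderCharge l) = K + ladderCharge l - 1 by ring]
    · have := h.creation_mulVec i
      simp only [if_true]
      rwa [show K + (1 + ladderCharge l) = K + ladderCharge l + 1 by ring]

/-- **Charged words have zero sector expectation**: for `IsNParticle N ψ` and `q(l) ≠ 0`,
`⟨ψ, ladderWord l ψ⟩ = 0`. [cite: Han2020Bootstrap, §2] -/
theorem star_dotProduct_ladderWord_mulVec_eq_zero {N : ℕ} {ψ : Fock ι} (hψ : IsNParticle N ψ)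
    (l : List (ι × Bool)) (hl : ladderCharge l ≠ 0) :
    star ψ ⬝ᵥ ladderWord l *ᵥ ψ = 0 := by
  have hZ := ((isZParticle_iff_isNParticle N ψ).mpr hψ).ladderWord_mulVec l
  rw [dotProduct]
  refine sum_eq_zero fun s _ => ?_
  by_cases hs : s.card = N
  · rw [hZ s (by rw [hs]; omega), mul_zero]
  · rw [Pi.star_apply, hψ s hs, star_zero, zero_mul]

end Literature.MathematicalPhysics.QuantumLattice
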